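import Summits.QuantumFields.YangMills.Theorems.ContinuumLimitOnTrajectory.Negative.WitnessRigidity

/-!
# `ContinuumLimitOnTrajectory` — negative-side support VI: the sector pinned by the lattice
# (`IsNontrivial` ⟺ a real time-separated pair; E1 on real product tensors)

Support file for crux `stmt-QuantumFields-10522` ((A) of `ParabolicTrajectory`), extracted from §4/§7 of the
standing disprover's work file `Cruxes/ContinuumLimitOnTrajectory/Disproof.lean` (cdisprove gen 3).

* `tsupport_T1_subset`, `tsupport_osAdjoint_T1_subset`, `osAdjoint_osAdjoint_eq`,
  `isNontrivial_of_truncated_ne_zero`, `isNontrivial_iff_exists_truncated_ne_zero`: `T.IsNontrivial s` holds iff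
  some REAL test functions `u` (negative times), `v` (positive times) have `𝔖₂ᵀ(u ⊗ v) ≠ 0` — the complex
  witness of the definition is never needed, and this is the form the lattice pins.
* `isOffDiagonal_linActMulti`: `⁰𝒮` is stable under the diagonal action of linear isometries (gap in the tree's
  API around `IsEuclideanInvariant`, via `ContinuousLinearMap.iteratedFDeriv_comp_right`).
* `rotTest`, `rotTest_apply`, `linActMulti_T2`, `linActMulti_T1`, `S2T_rotTest`: E1 of an OS datum on real
  product tensors: `𝔖₂ᵀ(u∘L⁻¹ ⊗ v∘L⁻¹) = 𝔖₂ᵀ(u ⊗ v)` for proper rotations `L` and `u ⊗ v ∈ ⁰𝒮`.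
* `tendsto_kernel_ratio_rotTest`: along a scheme carrying a witness, rotated and unrotated unit-normalised
  lattice kernel ratios have the SAME limit (the renormalisation-free form of rotational symmetry restoration).
-/

namespace Summit.QuantumFields.YangMills.Theorems.ContinuumLimitOnTrajectory.Negative

open MeasureTheory Filter Topology Complex
open scoped SchwartzMap ComplexConjugate
open Literature.MathematicalPhysics.QuantumFieldTheory Literature.MathematicalPhysics.QuantumLattice
open Literature.MathematicalPhysics.AQFT (IsOffDiagonal coincidenceLocus)
open Literature.Probability.LatticeModels (box)

noncomputable section

section Converse

variable {ι : Type}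

/-- Support of the one-variable tensor of a real test function. [folklore] -/
theorem tsupport_T1_subset (u : 𝓢((EuclideanSpace ℝ (Fin 4)), ℝ)) :
    tsupport (T1 u : (Fin 1 → (EuclideanSpace ℝ (Fin 4))) → ℂ) ⊆ {x | x 0 ∈ tsupport (u : (EuclideanSpace ℝ (Fin 4)) → ℝ)} := by
  have hcoe : (T1 u : (Fin 1 → (EuclideanSpace ℝ (Fin 4))) → ℂ) = (fun e : (EuclideanSpace ℝ (Fin 4)) => ((u e : ℝ) : ℂ)) ∘ fun x : Fin 1 → (EuclideanSpace ℝ (Fin 4)) => x 0 :=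
    funext fun x => T1_apply u x
  rw [hcoe]
  refine (_root_.tsupport_comp_subset_preimage _ (continuous_apply 0)).trans fun x hx => ?_
  exact (tsupport_comp_subset ofReal_zero (u : (EuclideanSpace ℝ (Fin 4)) → ℝ)) hx

/-- Support of the OS adjoint of the one-variable tensor of a real test function. [folklore] -/
theorem tsupport_osAdjoint_T1_subset (u : 𝓢((EuclideanSpace ℝ (Fin 4)), ℝ)) :
    tsupport (osAdjoint (T1 u) : (Fin 1 → (EuclideanSpace ℝ (Fin 4))) → ℂ) ⊆
      {x | timeReflection 4 (x 0) ∈ tsupport (u : (EuclideanSpace ℝ (Fin 4)) → ℝ)} := by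
  have hcoe : (osAdjoint (T1 u) : (Fin 1 → (EuclideanSpace ℝ (Fin 4))) → ℂ) =
      (fun e : (EuclideanSpace ℝ (Fin 4)) => conj ((u e : ℝ) : ℂ)) ∘ fun x : Fin 1 → (EuclideanSpace ℝ (Fin 4)) => timeReflection 4 (x 0) := by
    funext x
    rw [Function.comp_apply, osAdjoint_apply, T1_apply, Subsingleton.elim (Fin.rev (0 : Fin 1)) 0]
  rw [hcoe]
  refine (_root_.tsupport_comp_subset_preimage _
    ((timeReflection 4).continuous.comp (continuous_apply 0))).trans fun x hx => ?_
  have h1 : tsupport (fun e : (EuclideanSpace ℝ (Fin 4)) => conj ((u e : ℝ) : ℂ)) ⊆ tsupport (u : (EuclideanSpace ℝ (Fin 4)) → ℝ) :=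
    (tsupport_comp_subset (g := fun z : ℂ => conj z) (map_zero _) _).trans
      (tsupport_comp_subset ofReal_zero (u : (EuclideanSpace ℝ (Fin 4)) → ℝ))
  exact h1 hx

/-- The OS adjoint is an involution (pointwise proof; the tree's `osAdjoint_osAdjoint` lives in
`SchwingerOSCluster`, not imported here). [folklore] -/
theorem osAdjoint_osAdjoint_eq {n d : ℕ} [NeZero d] (F : 𝓢((Fin n → EuclideanSpace ℝ (Fin d)), ℂ)) :
    osAdjoint (osAdjoint F) = F := by
  ext x; simp [osAdjoint_apply, timeReflection_timeReflection, Fin.rev_rev]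

/-- **Conversely, a real time-separated pair with `𝔖₂ᵀ ≠ 0` witnesses `IsNontrivial`**: so
`T.IsNontrivial s ↔ ∃` real `u` (negative times), `v` (positive times) with `𝔖₂ᵀ(u ⊗ v) ≠ 0`. [folklore] -/
theorem isNontrivial_of_truncated_ne_zero (T : OSData ι 4) (s : ι) {u v : 𝓢((EuclideanSpace ℝ (Fin 4)), ℝ)}
    (hu : tsupport (u : (EuclideanSpace ℝ (Fin 4)) → ℝ) ⊆ {z | z 0 < 0}) (hv : tsupport (v : (EuclideanSpace ℝ (Fin 4)) → ℝ) ⊆ {z | 0 < z 0})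
    (hne : S2T T s u v ≠ 0) : T.IsNontrivial s := by
  have hmono : ∀ x : Fin 1 → (EuclideanSpace ℝ (Fin 4)), StrictMono fun i : Fin 1 => x i 0 := fun x a b hab =>
    absurd hab (by rw [Subsingleton.elim a b]; exact lt_irrefl _)
  refine ⟨osAdjoint (T1 u), T1 v, T2 u v, fun x hx => ⟨fun i => ?_, hmono x⟩,
    fun x hx => ⟨fun i => ?_, hmono x⟩, fun x => ?_, ?_⟩
  · have h := hu (tsupport_osAdjoint_T1_subset u hx)
    simp only [Set.mem_setOf_eq, timeReflection_apply, ↓reduceIte] at h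
    rw [Subsingleton.elim i 0]; linarith
  · have h := hv (tsupport_T1_subset v hx)
    rw [Subsingleton.elim i 0]; exact h
  · rw [osAdjoint_osAdjoint_eq, T2_apply, T1_apply, T1_apply]; rfl
  · rw [osAdjoint_osAdjoint_eq]; exact sub_ne_zero.1 hne

/-- **Characterisation of non-triviality by real time-separated pairs.** [folklore] -/
theorem isNontrivial_iff_exists_truncated_ne_zero (T : OSData ι 4) (s : ι) :
    T.IsNontrivial s ↔ ∃ u v : 𝓢((EuclideanSpace ℝ (Fin 4)), ℝ), tsupport (u : (EuclideanSpace ℝ (Fin 4)) → ℝ) ⊆ {z | z 0 < 0} ∧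
      tsupport (v : (EuclideanSpace ℝ (Fin 4)) → ℝ) ⊆ {z | 0 < z 0} ∧ S2T T s u v ≠ 0 :=
  ⟨exists_truncated_ne_zero_of_isNontrivial T s, fun ⟨_, _, hu, hv, hne⟩ =>
    isNontrivial_of_truncated_ne_zero T s hu hv hne⟩

end Converse

section Rotation

open Literature.MathematicalPhysics.AQFT (IsOffDiagonal coincidenceLocus)

variable {E : Type*} [NormedAddCommGroup E] [NormedSpace ℝ E] {n : ℕ}

/-- **`⁰𝒮` is stable under the diagonal action of linear isometries.** [folklore] -/
theorem isOffDiagonal_linActMulti {F : 𝓢((Fin n → E), ℂ)} (hF : IsOffDiagonal F)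
    (L : E ≃ₗᵢ[ℝ] E) : IsOffDiagonal (linActMulti L F) := by
  intro x hx k
  set Φ : (Fin n → E) ≃L[ℝ] (Fin n → E) :=
    ContinuousLinearEquiv.piCongrRight fun _ : Fin n => L.symm.toContinuousLinearEquiv with hΦ
  have hcoe : ((linActMulti L F : 𝓢((Fin n → E), ℂ)) : (Fin n → E) → ℂ) =
      (F : (Fin n → E) → ℂ) ∘ (Φ : (Fin n → E) →L[ℝ] (Fin n → E)) := by
    funext y; simp only [Function.comp_apply, linActMulti_apply, hΦ]; rfl
  have hΦx : Φ x ∈ coincidenceLocus n E := by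
    obtain ⟨i, j, hij, h⟩ := hx
    refine ⟨i, j, hij, ?_⟩
    show L.symm (x i) = L.symm (x j)
    rw [h]
  rw [hcoe, ContinuousLinearMap.iteratedFDeriv_comp_right (Φ : (Fin n → E) →L[ℝ] (Fin n → E))
    (F.smooth k) x le_rfl]
  have h0 : iteratedFDeriv ℝ k (F : (Fin n → E) → ℂ) (Φ x) = 0 := hF _ hΦx k
  rw [show ((Φ : (Fin n → E) →L[ℝ] (Fin n → E)) x) = Φ x from rfl, h0]
  ext; simp

/-- A real test function composed with a linear isometry of `ℝ⁴` (`u ∘ L⁻¹`). [folklore] -/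
def rotTest (L : (EuclideanSpace ℝ (Fin 4)) ≃ₗᵢ[ℝ] (EuclideanSpace ℝ (Fin 4))) (u : 𝓢((EuclideanSpace ℝ (Fin 4)), ℝ)) : 𝓢((EuclideanSpace ℝ (Fin 4)), ℝ) :=
  SchwartzMap.compCLMOfContinuousLinearEquiv ℝ L.symm.toContinuousLinearEquiv u

/-- `rotTest L u x = u (L⁻¹ x)`. [folklore] -/
theorem rotTest_apply (L : (EuclideanSpace ℝ (Fin 4)) ≃ₗᵢ[ℝ] (EuclideanSpace ℝ (Fin 4))) (u : 𝓢((EuclideanSpace ℝ (Fin 4)), ℝ)) (x : (EuclideanSpace ℝ (Fin 4))) : rotTest L u x = u (L.symm x) := by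
  simp [rotTest, SchwartzMap.compCLMOfContinuousLinearEquiv_apply]

/-- The diagonal action of `L` on a real two-variable product tensor. [folklore] -/
theorem linActMulti_T2 (L : (EuclideanSpace ℝ (Fin 4)) ≃ₗᵢ[ℝ] (EuclideanSpace ℝ (Fin 4))) (u v : 𝓢((EuclideanSpace ℝ (Fin 4)), ℝ)) :
    linActMulti L (T2 u v) = T2 (rotTest L u) (rotTest L v) := by
  ext x; simp [linActMulti_apply, T2_apply, rotTest_apply]

/-- The diagonal action of `L` on a real one-variable tensor. [folklore] -/
theorem linActMulti_T1 (L : (EuclideanSpace ℝ (Fin 4)) ≃ₗᵢ[ℝ] (EuclideanSpace ℝ (Fin 4))) (u : 𝓢((EuclideanSpace ℝ (Fin 4)), ℝ)) :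
    linActMulti L (T1 u) = T1 (rotTest L u) := by
  ext x; simp [linActMulti_apply, T1_apply, rotTest_apply]

variable {ι : Type}

/-- **E1 on the pinned sector**: the truncated two-point function of an OS datum is invariant
under proper rotations of a real off-diagonal pair. [folklore] -/
theorem S2T_rotTest (T : OSData ι 4) (s : ι) (L : (EuclideanSpace ℝ (Fin 4)) ≃ₗᵢ[ℝ] (EuclideanSpace ℝ (Fin 4)))
    (hL : LinearMap.det (L.toLinearEquiv : (EuclideanSpace ℝ (Fin 4)) →ₗ[ℝ] (EuclideanSpace ℝ (Fin 4))) = 1) {u v : 𝓢((EuclideanSpace ℝ (Fin 4)), ℝ)}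
    (huv : IsOffDiagonal (T2 u v)) :
    S2T T s (rotTest L u) (rotTest L v) = S2T T s u v := by
  unfold S2T
  rw [← linActMulti_T2, ← linActMulti_T1, ← linActMulti_T1,
    T.invariant.2 _ _ L hL _ huv, T.invariant.2 _ _ L hL _ (isOffDiagonal_one _),
    T.invariant.2 _ _ L hL _ (isOffDiagonal_one _)]

variable {G : Type} [Group G] [TopologicalSpace G] [IsTopologicalGroup G] [CompactSpace G]
  [MeasurableSpace G] [BorelSpace G]

/-- **Rotated and unrotated kernel ratios have the same limit** along a scheme carrying a
witness. [folklore] -/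
theorem tendsto_kernel_ratio_rotTest (r : LatticeRep G) (sch : SpeciesScheme (YMSpecies G))
    (T : OSData (YMSpecies G) 4) (hT : IsYangMillsFor r sch T) {u₀ v₀ u v : 𝓢((EuclideanSpace ℝ (Fin 4)), ℝ)}
    (h₀ : IsOffDiagonal (T2 u₀ v₀)) (hne : S2T T r.curvature u₀ v₀ ≠ 0)
    (huv : IsOffDiagonal (T2 u v)) (L : (EuclideanSpace ℝ (Fin 4)) ≃ₗᵢ[ℝ] (EuclideanSpace ℝ (Fin 4)))
    (hL : LinearMap.det (L.toLinearEquiv : (EuclideanSpace ℝ (Fin 4)) →ₗ[ℝ] (EuclideanSpace ℝ (Fin 4))) = 1) :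
    Tendsto (fun k => ((twoPointKernel r.ρ (sch.a k) (sch.β k) (sch.L k) (rotTest L u) (rotTest L v) /
        twoPointKernel r.ρ (sch.a k) (sch.β k) (sch.L k) u₀ v₀ : ℝ) : ℂ)) atTop
      (𝓝 (S2T T r.curvature u v / S2T T r.curvature u₀ v₀)) := by
  have h := tendsto_kernel_ratio r sch T hT h₀ hne
    (by rw [← linActMulti_T2]; exact isOffDiagonal_linActMulti huv L)
  rwa [S2T_rotTest T r.curvature L hL huv] at h

end Rotation

end

end Summit.QuantumFields.YangMills.Theorems.ContinuumLimitOnTrajectory.Negative
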